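import Summits.AtomisticToContinuum.Crystallization.Theses.PhononSlackCertificates
import Summits.AtomisticToContinuum.Crystallization.Theorems.PhononSlackCertificatesAllBadGap
import Summits.AtomisticToContinuum.Crystallization.Theorems.ChargedEnergyGap.Negative.Unconditional
import Literature.MathematicalPhysics.StatisticalMechanics.LennardJonesClusters

/-!
# Disproof of `FarFieldGapR` (stmt-AtomisticToContinuum-14969) — findings

Refuter work file of the cdisprove seat (route `PhononSlackCertificates`, rank-2 crux; line
`Sketch` = octahedral-poisoning collapse `AllBadGap → FarFieldGapR`, lead
prover-line-stmt-AtomisticToContinuum-14969-0).  Everything below is sorry-free and checked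
(`lean check` rc 0); the conclusive parts are filed under `Theorems/FarFieldGapR/Negative/`.

VERDICT OF CYCLE 1: **no kill; the crux resists for a structural reason.**  With the landed
converse `allBadGap_of_farFieldGapR` and the line `Sketch` (all seven stubs survive the attacks
below) the crux is literally EQUIVALENT to the all-bad bulk gap `AllBadGap` (stmt-13960):
"`δ`-separated Lennard-Jones matter with no `1/20`-fcc/hcp two-shell environment is uniformly worse
per particle than `e* = ⨅_Q e(Q)`".  A refutation must exhibit all-bad configurations with
`𝓔 < N (e* + g)` for EVERY `g > 0` (`not_farFieldGapR_of_allBad_tie`), i.e. it must bound `e*`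
from BELOW to within the all-bad deficit — the open identification of the periodic LJ minimum
(BlancLewin2015 §2.3); the tree knows `e*` only as an infimum (upper bounds by competitors,
`card_mul_eStar_le`; lower bound = an inexplicit stability constant).  Physically the cheapest
all-bad bulk costs `≈ 0.4–1 %` of `|e*|` per particle (homogeneous strain just past the `a/20`
misfit: 0.0042 by the ideator-2 Cauchy–Born numerics; vacancy/interstitial superlattices ≳ 0.04;
bcc +4 %, sc/A15/Frank–Kasper/icosahedral bulk worse; every Barlow polytype is GOOD, not bad), so
no tie is in sight either.  Conversely a PROOF needs only an upper level `ē ≥ e*`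
(`allBadGap_of_level`) — the asymmetry that makes this crux provable-in-principle but
unfalsifiable-in-practice.  THE DICHOTOMY: the only UNCONDITIONAL refutation mechanism (one that beats
an unknown real `e*`) is a site energy unbounded below, i.e. crowding as `δ → 0`; the crux defeats
it by choosing `g, C, R` after `δ`, and exactly the `δ`-uniform variants fall to it (§1–§2 below);
every other kill needs `e*` from below.  WHAT WOULD UNLOCK FURTHER NEGATIVES: an explicit Lennard-Jones
stability constant `B` with `E(N) ≥ -B N`, `B < 6` say (the tree's `lennardJones_stable_holds` has
`B = 2³²/12`; print has near-optimal constants), which gives `e* ≥ -B` and would let fixed-`δ`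
witnesses at the design point `δ = 1/3` (a `1/3`-separated shell crowd has site energy `≈ -6`)
refute the pointwise far field and pin `C(1/3) > 0`, `R(1/3) > …` quantitatively.

## Index

§0 `At δ g C R` — the crux parametrised (`farFieldGapR_iff`, `Iff.rfl`); monotonicity
   (`At.mono_R`: WLOG `R` large; `At.anti_g`, `At.mono_C`, `At.mono_δ`); tightness
   `At.g_le_neg_eStar : g ≤ -e*` (one particle); `At.g_le_energy_div : g ≤ 𝓔(x)/N - e*` for every
   explicit all-bad competitor `x` (the slot for certified block energies).
§1 LOAD-BEARING HYPOTHESES (each dropped hypothesis kills the statement):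
   * `not_withoutSep`   — separation: a crowd of `M` particles at distance `1` from one bad particle.
   * `not_fixedRadius R₀` — "`R` after `δ`": ANY fixed slack radius is refuted by an isolated bad
     particle with empty `R₀`-boundary in front of `K` collinear `1/K`-separated particles
     (re-lands `¬FarFieldGap`, stmt-13957, for every radius at once); so `R(δ) → ∞` as `δ → 0`.
   * `not_uniformC`     — "`C` after `δ`": no `δ`-uniform boundary constant; `C(δ) → ∞`.
   * `At.floor_inv_le_C`, `At.floor_inv_le_R` (ray, 1-D) and `At.floor_inv_cube_le_C`,
     `At.floor_inv_cube_le_R` (cube cloud, 3-D) — the quantitative versions: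
     `|C| ≥ ⌊δ⁻¹⌋³/98304 + e*` (so `C(δ) ≳ δ⁻³`) and `(max R 2 + 3)⁶ ≥ ⌊δ⁻¹⌋³/(24|e*|)` (so
     `R(δ) ≳ δ^{-1/2}`); the planner's heuristics are `C ~ δ⁻⁶`, `R ~ 1.2/δ`.
   * `not_withoutBad`   — badness of `U`: ground states (`δ₀`-separated, `E(N) = N e* + o(N)`,
     proved tree facts) with `U =` everything beat any `g > 0`.
§2 NATURAL STRENGTHENINGS REFUTED:
   * `not_pointwise` — the POINTWISE far field ("an `R`-interior bad particle has site energy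
     `≥ e* + g`", which implies the crux: `farFieldGapR_of_pointwise`) is FALSE: bad neighbours
     crowding a bad particle push its site energy below `e*` at no pointwise cost; the crowd's own
     repulsion pays only in the SUM.  Lesson for provers: certificates must transfer energy between
     neighbouring bad particles (the card's transfer certificates); no site-by-site bound exists.
§3 WHAT A KILL MUST LOOK LIKE: `farFieldGapR_iff_allBadGap` (modulo the line),
   `not_farFieldGapR_of_allBad_tie` (kill criterion (i) made formal), `allBadGap_of_level`; and the
   core `AllBadGap` has the same two load-bearing hypotheses (`not_allBad_withoutSep`: the pile-up;
   `not_allBad_withoutBad`: ground states).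

## A route-shape remark (for the planner; no verdict)

The crux quantifies over EVERY subset `U` of bad particles and every `δ`, but the route consumes
only the instance `U = all bad particles` at `δ = 1/3` (`NearFarGlueR`, `closes`).  The forced
growth `C(δ) ≳ δ⁻³`, `R(δ) → ∞` of §1 is an artefact of the subset freedom alone: all witnesses
put dense BAD matter in the complement of `U`.  With `U` maximal the complement is GOOD, hence
`0.95a`-separated near `U` (a good particle's `3a/2`-ball is pattern-matched), and dense bad matter
pays its own repulsion inside the sum — heuristically the maximal-`U` version holds with
`δ`-uniform `C, R`.  Modulo the line `Sketch` both versions collapse to `AllBadGap`, so the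
generality costs nothing in provability; it only costs constants.

## Line `Sketch` — targets (stubs `hole, tail, local, decomp, iter, step, glue`)

No stub broken; joint sufficiency is honest (`FarFieldGapR_of` is a real composition, the only
open input is `AllBadGap`).  Margins re-derived by hand (refuter, this cycle):
* `stub_hole`: `h = e₀/√2`; fcc model `(1,0,0)`: octahedron vertices `(2,0,0),(0,0,0),(1,±1,0),
  (1,0,±1)` ∈ `insert 0 P`, min distance² to pattern = 1 (→ `1/√2`); hcp model `(3,0,0)/√18`:
  vertices `(6,0,0),(0,0,0)`, `(3,3,0),(3,0,3)` (layer +1), `(3,-3,0),(3,0,-3)` (in-plane) — all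
  present; min distance² = 9 (→ `1/√2`).  TRUE (decidable arithmetic).
* `stub_tail`: shell count `(2(b+1)R/δ+1)³ ≤ (5bR/δ)³` for `R ≥ δ`, `b ≥ 1`; `Σ b⁻³ ≤ 2`; TRUE.
  (`δ ≤ R` is used only through `R > 0`; for `0 < R < δ` the bound is weaker than
  `sum_inv_pow_six_le` and still true.)
* `stub_local`, `stub_decomp`, `stub_iter`: bookkeeping, TRUE (`stub_iter` needs `K ≥ 0`: one
  insertion may kill several good particles, so fewer than `#good` steps occur).
* `stub_step`: (1) `0.745 + a/√2 ≤ 3a/2 ⇔ a ≥ 0.93959` — holds on the window `a ≥ 0.94` with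
  margin `3·10⁻⁴` only (with `1/√2 ≤ 0.7072`: `0.7928·0.94 = 0.74523 ≥ 0.745`, still fine);
  matched particles `≥ a(1/√2 - 1/20) ≥ 0.6177 > 3/5`; (2) the six octahedron particles sit at
  `≤ 0.7572 < 0.893 ≤ 0.95a'` from `z`, so `z` is bad; (3) alignment: `|d - (a/√2)u| ≤ 1.21` for
  `|d| ≤ (√2+1/20)a'`, `⟨d,u⟩ ≥ |d|/√3`, plus `a/20` gives `≤ 1.26 < 1.41 ≤ 3a'/2`; assigned
  distinct pattern points force `|z - p| ≥ 0.9a' ≥ 0.846 > 0.7572`; TRUE.  The hypothesis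
  `δ ≤ 3/5` is load-bearing by design (`z` may be `0.6177`-close to a displaced octahedron
  particle), harmless since the glue runs at `min δ (3/5)`.
* `stub_glue`: `C = K + |e*| + g₀ + (250/12)δ⁻⁶`, `g = g₀/2`, `(250/12)δ⁻³R⁻³ ≤ g₀/2`; the sign
  split on `e* + g₀` is covered by `|e*|`; `#good(x|_U) ≤ #∂_R U` via `stub_local` needs `R ≥ 3/2`
  (it takes `R ≥ max (3/2) δ`); TRUE.

## Attacks that found nothing (recorded so nobody repeats them)

degenerate `N = 0, 1`, `U = ∅` (trivial / `g ≤ -e*`); `δ > 21/20` (everything bad, item is the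
plain floor, margin ≈ 13 %); dense `δ`-cloud beyond `R` (defeated by `R(δ)`, quantified in
`not_fixedRadius`); crowd inside `R` (defeated by `C(δ)`, quantified in `not_uniformC`); slab +
vacuum gap + dense wall (area law, `R ≳ δ^{-3/2}`); strained / vacancy-decorated / interstitial-
poisoned crystals, bcc, sc, icosahedral and Frank–Kasper bulk (all pay ≥ 0.4 % of `|e*|` per
particle, uncertified numerics of the route and ideator 2); Barlow polytypes (all GOOD: the
18-point neighbourhood sees only adjacent layers).  Literature: no printed periodic or
quasiperiodic LJ structure within `10⁻³|e*|` of hcp other than Barlow stackings (Stillinger2001,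
BeterminSamajTravenec2022 as cited by the route; not re-verified page-level this cycle).
-/

noncomputable section

namespace Summit.AtomisticToContinuum.Crystallization.Cruxes.FarFieldGapR.Disproof

open scoped BigOperators Classical
open Literature.MathematicalPhysics.StatisticalMechanics Literature.Geometry.DiscreteGeometry
open Summit.AtomisticToContinuum.Crystallization.Theses.PhononSlackCertificates
  (AllBadGap FarFieldGapR CoerciveTwoShellGap)
open Summit.AtomisticToContinuum.Crystallization.Theorems.ChargedEnergyGapNegative
  (E3 eStar e0 norm_e0 card_mul_eStar_le crysEnergyLimit pile interactionEnergy_pile)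
open Summit.AtomisticToContinuum.Crystallization.Theorems.PhononSlackCertificatesAllBadGap
  (exists_mem_norm_eq_one sum_univ_half_site_sub allBadGap_of_farFieldGapR)

/-! ## §0 The crux, parametrised -/

/-- The far-field inequality at fixed parameters `(δ, g, C, R)`. [folklore] -/
def At (δ g C R : ℝ) : Prop :=
  ∀ (N : ℕ) (x : Fin N → E3), (∀ i j : Fin N, i ≠ j → δ ≤ dist (x i) (x j)) →
    ∀ U : Finset (Fin N), (∀ i ∈ U, ¬ IsTwoShellGood (1 / 20) (47 / 50) 1 x i) →
      g * (U.card : ℝ) -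
          C * (Nat.card {i : Fin N // i ∈ U ∧ ∃ j : Fin N, j ∉ U ∧ dist (x j) (x i) ≤ R} : ℝ) ≤
        ∑ i ∈ U, ((1 / 2 : ℝ) * (∑ j ∈ Finset.univ.erase i, lennardJones (dist (x i) (x j))) -
          eStar)

/-- `FarFieldGapR` is `∀ δ > 0, ∃ g > 0, ∃ C R, At δ g C R`, by `Iff.rfl`. [folklore] -/
theorem farFieldGapR_iff :
    FarFieldGapR ↔ ∀ δ : ℝ, 0 < δ → ∃ g : ℝ, 0 < g ∧ ∃ C R : ℝ, At δ g C R :=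
  Iff.rfl

/-! ### Elementary helpers -/

/-- The boundary count never exceeds `#U`. [folklore] -/
theorem natCard_bdry_le_card {N : ℕ} (x : Fin N → E3) (U : Finset (Fin N)) (R : ℝ) :
    (Nat.card {i : Fin N // i ∈ U ∧ ∃ j : Fin N, j ∉ U ∧ dist (x j) (x i) ≤ R} : ℝ) ≤ U.card := by
  have h : Nat.card {i : Fin N // i ∈ U ∧ ∃ j : Fin N, j ∉ U ∧ dist (x j) (x i) ≤ R} ≤ U.card := by
    rw [Nat.card_eq_fintype_card, Fintype.card_subtype]
    exact Finset.card_le_card fun i hi => (Finset.mem_filter.1 hi).2.1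
  exact_mod_cast h

/-- With a single particle nothing is good (there is nobody to match a pattern point). [folklore] -/
theorem not_isTwoShellGood_fin_one {ε lo hi : ℝ} (x : Fin 1 → E3) (i : Fin 1) :
    ¬ IsTwoShellGood ε lo hi x i := by
  rintro ⟨a, -, -, A, P, f, hP, hf, -, -⟩
  obtain ⟨v, hv, -⟩ := exists_mem_norm_eq_one hP
  exact (hf v hv).1 (Subsingleton.elim _ _)

/-- **An isolated particle is bad**: if no other particle lies within distance `3/2` of `x i`, then
`i` is not `1/20`-good on the window `[47/50, 1]` (a good particle has a matched first-shell
neighbour within `21a/20 ≤ 21/20`). [folklore] -/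
theorem not_isTwoShellGood_of_isolated {N : ℕ} {x : Fin N → E3} {i : Fin N}
    (h : ∀ j : Fin N, j ≠ i → 3 / 2 < dist (x j) (x i)) :
    ¬ IsTwoShellGood (1 / 20) (47 / 50) 1 x i := by
  rintro ⟨a, ha₁, ha₂, A, P, f, hP, hf, -, -⟩
  obtain ⟨v, hv, hv1⟩ := exists_mem_norm_eq_one hP
  obtain ⟨hne, hd⟩ := hf v hv
  have ha0 : 0 ≤ a := by linarith
  have hAv : dist (x i + a • A v) (x i) = a := by
    rw [dist_eq_norm, add_sub_cancel_left, norm_smul, A.norm_map, hv1, mul_one,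
      Real.norm_of_nonneg ha0]
  have h1 : dist (x (f v)) (x i) ≤ 1 / 20 * a + a := by
    calc dist (x (f v)) (x i)
        ≤ dist (x (f v)) (x i + a • A v) + dist (x i + a • A v) (x i) := dist_triangle _ _ _
      _ ≤ 1 / 20 * a + a := by rw [hAv]; exact add_le_add hd le_rfl
  have h2 := h (f v) hne
  linarith

/-- `√2 ≤ 29/20`, so the route's tolerance `1/20 ≤ 3/2 - √2`. [folklore] -/
theorem one_div_twenty_le : (1 / 20 : ℝ) ≤ 3 / 2 - Real.sqrt 2 := by
  have h : Real.sqrt 2 ≤ 29 / 20 := by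
    rw [Real.sqrt_le_left (by norm_num)]
    norm_num
  linarith

/-- **A crowded particle is bad**: if at least `19` other particles lie within distance `141/100`
(`= 3/2 · 47/50 ≤ 3a/2`) of `x i`, then `i` is not good (a good particle has EXACTLY eighteen other
particles within `3a/2`, `IsTwoShellGood.card_filter_eq_eighteen`). [folklore] -/
theorem not_isTwoShellGood_of_crowded {N : ℕ} {x : Fin N → E3} {i : Fin N} (S : Finset (Fin N))
    (hS : 19 ≤ S.card) (hSi : ∀ j ∈ S, j ≠ i ∧ dist (x j) (x i) ≤ 141 / 100) :
    ¬ IsTwoShellGood (1 / 20) (47 / 50) 1 x i := by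
  intro hgood
  obtain ⟨a, ha₁, -, hcard⟩ := hgood.card_filter_eq_eighteen (by norm_num) one_div_twenty_le
  have hsub : S ⊆ Finset.univ.filter fun j : Fin N => j ≠ i ∧ dist (x j) (x i) ≤ 3 / 2 * a := by
    intro j hj
    obtain ⟨hji, hd⟩ := hSi j hj
    exact Finset.mem_filter.2 ⟨Finset.mem_univ _, hji, hd.trans (by linarith)⟩
  have := Finset.card_le_card hsub
  omega

/-! ### Parameter structure: monotonicity, and `g ≤ -e*` -/

/-- Larger slack radius is weaker (for `C ≥ 0`): WLOG `R` is as large as we please. [folklore] -/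
theorem At.mono_R {δ g C R R' : ℝ} (hC : 0 ≤ C) (hR : R ≤ R') (h : At δ g C R) : At δ g C R' := by
  intro N x hsep U hU
  have key := h N x hsep U hU
  have hle : (Nat.card {i : Fin N // i ∈ U ∧ ∃ j : Fin N, j ∉ U ∧ dist (x j) (x i) ≤ R} : ℝ) ≤
      Nat.card {i : Fin N // i ∈ U ∧ ∃ j : Fin N, j ∉ U ∧ dist (x j) (x i) ≤ R'} := by
    exact_mod_cast Nat.card_le_card_of_injective
      (fun p : {i : Fin N // i ∈ U ∧ ∃ j : Fin N, j ∉ U ∧ dist (x j) (x i) ≤ R} =>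
        (⟨p.1, p.2.1, p.2.2.imp fun j hj => ⟨hj.1, hj.2.trans hR⟩⟩ :
          {i : Fin N // i ∈ U ∧ ∃ j : Fin N, j ∉ U ∧ dist (x j) (x i) ≤ R'}))
      (fun p q hpq => Subtype.ext (by simpa using congrArg Subtype.val hpq))
  nlinarith

/-- Smaller gap constant is weaker. [folklore] -/
theorem At.anti_g {δ g g' C R : ℝ} (hg : g' ≤ g) (h : At δ g C R) : At δ g' C R := by
  intro N x hsep U hU
  have key := h N x hsep U hU
  have : (0 : ℝ) ≤ U.card := Nat.cast_nonneg _
  nlinarith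

/-- Larger boundary constant is weaker. [folklore] -/
theorem At.mono_C {δ g C C' R : ℝ} (hC : C ≤ C') (h : At δ g C R) : At δ g C' R := by
  intro N x hsep U hU
  have key := h N x hsep U hU
  have : (0 : ℝ) ≤ Nat.card {i : Fin N // i ∈ U ∧ ∃ j : Fin N, j ∉ U ∧ dist (x j) (x i) ≤ R} :=
    Nat.cast_nonneg _
  nlinarith

/-- Larger separation is weaker. [folklore] -/
theorem At.mono_δ {δ δ' g C R : ℝ} (hδ : δ ≤ δ') (h : At δ g C R) : At δ' g C R :=
  fun N x hsep U hU => h N x (fun i j hij => hδ.trans (hsep i j hij)) U hU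

/-- **Tightness in `g`: `g ≤ -e*`** for every admissible `(δ, g, C, R)` (one particle alone:
`U = {0}` is bad, has empty boundary and excess `-e*`).  In particular the crux forces `e* < 0`
(true: `e* ≤ E(2)/2 = -1/24`). [folklore] -/
theorem At.g_le_neg_eStar {δ g C R : ℝ} (h : At δ g C R) : g ≤ -eStar := by
  have key := h 1 (fun _ => 0) (fun i j hij => absurd (Subsingleton.elim i j) hij) Finset.univ
    (fun i _ => not_isTwoShellGood_fin_one _ i)
  haveI : IsEmpty {i : Fin 1 // i ∈ (Finset.univ : Finset (Fin 1)) ∧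
      ∃ j : Fin 1, j ∉ (Finset.univ : Finset (Fin 1)) ∧ dist ((fun _ => (0 : E3)) j) ((fun _ => (0 : E3)) i) ≤ R} :=
    ⟨fun ⟨_, _, j, hj, _⟩ => hj (Finset.mem_univ j)⟩
  rw [Nat.card_of_isEmpty, sum_univ_half_site_sub, Finset.card_univ, Fintype.card_fin,
    interactionEnergy_of_subsingleton] at key
  push_cast at key
  linarith

/-- **Tightness in `g`, general form**: every explicit all-bad `δ`-separated configuration `x`
with `N ≥ 1` particles caps the gap constant, `g ≤ 𝓔(x)/N - e*` (take `U =` everything).  With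
`N = 1` this is `g ≤ -e*`; certified block energies of count-bad competitors (expanded fcc with
nearest-neighbour distance `> 3/(2√2) ≈ 1.061`, twelve neighbours within `3a/2`; bcc, fourteen)
would give `g ≲ 0.14` resp. `0.03`, and the uncertified strained-fcc numerics give `g ≤ 0.0042`.
[folklore] -/
theorem At.g_le_energy_div {δ g C R : ℝ} (h : At δ g C R) {N : ℕ} (hN : 0 < N) {x : Fin N → E3}
    (hsep : ∀ i j : Fin N, i ≠ j → δ ≤ dist (x i) (x j))
    (hbad : ∀ i, ¬ IsTwoShellGood (1 / 20) (47 / 50) 1 x i) :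
    g ≤ interactionEnergy lennardJones x / N - eStar := by
  have key := h N x hsep Finset.univ (fun i _ => hbad i)
  haveI : IsEmpty {i : Fin N // i ∈ (Finset.univ : Finset (Fin N)) ∧
      ∃ j : Fin N, j ∉ (Finset.univ : Finset (Fin N)) ∧ dist (x j) (x i) ≤ R} :=
    ⟨fun ⟨_, _, j, hj, _⟩ => hj (Finset.mem_univ j)⟩
  rw [Nat.card_of_isEmpty, sum_univ_half_site_sub, Finset.card_univ, Fintype.card_fin] at key
  have hNr : (0 : ℝ) < N := by exact_mod_cast hN
  push_cast at key
  rw [le_sub_iff_add_le, le_div_iff₀ hNr]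
  nlinarith

/-! ## §1 Load-bearing hypotheses -/

/-- The crux with the SEPARATION hypothesis dropped (then `δ` is idle, so it is dropped too). [folklore] -/
def WithoutSep : Prop :=
  ∃ g : ℝ, 0 < g ∧ ∃ C R : ℝ, ∀ (N : ℕ) (x : Fin N → E3) (U : Finset (Fin N)),
    (∀ i ∈ U, ¬ IsTwoShellGood (1 / 20) (47 / 50) 1 x i) →
      g * (U.card : ℝ) -
          C * (Nat.card {i : Fin N // i ∈ U ∧ ∃ j : Fin N, j ∉ U ∧ dist (x j) (x i) ≤ R} : ℝ) ≤
        ∑ i ∈ U, ((1 / 2 : ℝ) * (∑ j ∈ Finset.univ.erase i, lennardJones (dist (x i) (x j))) -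
          eStar)

/-- The crowd: one particle at the origin and `M` particles piled up at `e₀` (distance `1`). [folklore] -/
def crowd (M : ℕ) : Fin (M + 1) → E3 := Matrix.vecCons (0 : E3) fun _ : Fin M => e0

@[simp] theorem crowd_zero (M : ℕ) : crowd M 0 = 0 := rfl

@[simp] theorem crowd_succ (M : ℕ) (k : Fin M) : crowd M k.succ = e0 := by
  simp [crowd]

/-- The excess site energy of the central particle of the crowd is `-M/24 - e*`. [folklore] -/
theorem crowd_sum (M : ℕ) :
    ∑ i ∈ ({0} : Finset (Fin (M + 1))),
        ((1 / 2 : ℝ) * (∑ j ∈ Finset.univ.erase i, lennardJones (dist (crowd M i) (crowd M j))) -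
          eStar) = -(M : ℝ) / 24 - eStar := by
  rw [Finset.sum_singleton]
  have h : ∑ j ∈ Finset.univ.erase (0 : Fin (M + 1)), lennardJones (dist (crowd M 0) (crowd M j)) =
      ∑ j : Fin (M + 1), lennardJones (dist (crowd M 0) (crowd M j)) := by
    rw [← Finset.add_sum_erase _ _ (Finset.mem_univ (0 : Fin (M + 1)))]
    simp [lennardJones_zero]
  rw [h, Fin.sum_univ_succ]
  simp [lennardJones_zero, lennardJones_one]
  ring

/-- **Separation is load-bearing**: without it a single bad particle with a crowd of `M` particles
at distance `1` has excess site energy `-M/24 - e* → -∞`, against a left side `≥ g - |C|`.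
Any proof of the crux must use the `δ`-separation. [folklore] -/
theorem not_withoutSep : ¬ WithoutSep := by
  rintro ⟨g, hg, C, R, h⟩
  obtain ⟨M₀, hM₀⟩ := exists_nat_gt (24 * (|C| + |eStar|) + 19)
  set M := M₀ with hM
  have hM19 : 19 ≤ M := by
    have : (19 : ℝ) ≤ M₀ := by
      have h0 : 0 ≤ 24 * (|C| + |eStar|) := by positivity
      linarith
    exact_mod_cast this
  have hbad : ∀ i ∈ ({0} : Finset (Fin (M + 1))), ¬ IsTwoShellGood (1 / 20) (47 / 50) 1 (crowd M) i := by
    intro i hi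
    rw [Finset.mem_singleton] at hi
    subst hi
    refine not_isTwoShellGood_of_crowded (Finset.univ.image Fin.succ) ?_ ?_
    · rw [Finset.card_image_of_injective _ (Fin.succ_injective _), Finset.card_univ,
        Fintype.card_fin]
      exact hM19
    · intro j hj
      obtain ⟨k, -, rfl⟩ := Finset.mem_image.1 hj
      refine ⟨Fin.succ_ne_zero k, ?_⟩
      simp only [crowd_succ, crowd_zero, dist_zero_right, norm_e0]
      norm_num
  have key := h (M + 1) (crowd M) {0} hbad
  rw [crowd_sum, Finset.card_singleton] at key
  have hb := natCard_bdry_le_card (crowd M) ({0} : Finset (Fin (M + 1))) R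
  rw [Finset.card_singleton] at hb
  push_cast at key hb
  have hb0 : (0 : ℝ) ≤ Nat.card {i : Fin (M + 1) // i ∈ ({0} : Finset (Fin (M + 1))) ∧
      ∃ j : Fin (M + 1), j ∉ ({0} : Finset (Fin (M + 1))) ∧ dist (crowd M j) (crowd M i) ≤ R} :=
    Nat.cast_nonneg _
  have hC : -|C| ≤ -(C * (Nat.card {i : Fin (M + 1) // i ∈ ({0} : Finset (Fin (M + 1))) ∧
      ∃ j : Fin (M + 1), j ∉ ({0} : Finset (Fin (M + 1))) ∧ dist (crowd M j) (crowd M i) ≤ R} : ℝ)) := by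
    rw [neg_le_neg_iff]
    calc C * _ ≤ |C| * _ := by exact mul_le_mul_of_nonneg_right (le_abs_self C) hb0
      _ ≤ |C| * 1 := by exact mul_le_mul_of_nonneg_left hb (abs_nonneg C)
      _ = |C| := mul_one _
  have he : -|eStar| ≤ eStar := neg_abs_le eStar
  linarith


/-! ### The ray witness (dense collinear matter; separation `1/K`) -/

/-- One particle at the origin and `K` particles on the ray `ℝ₊ e₀` at distances `L + k/K`,
`k < K` (mutual spacing `1/K`, all at distance `∈ [L, L+1)` from the origin). [folklore] -/
def ray (L : ℝ) (K : ℕ) : Fin (K + 1) → E3 :=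
  Matrix.vecCons (0 : E3) fun k : Fin K => (L + (k : ℝ) / K) • e0

@[simp] theorem ray_zero (L : ℝ) (K : ℕ) : ray L K 0 = 0 := rfl

@[simp] theorem ray_succ (L : ℝ) (K : ℕ) (k : Fin K) :
    ray L K k.succ = (L + (k : ℝ) / K) • e0 := by
  simp [ray]

theorem dist_ray_zero_succ {L : ℝ} (hL : 0 ≤ L) (K : ℕ) (k : Fin K) :
    dist (ray L K 0) (ray L K k.succ) = L + (k : ℝ) / K := by
  have h0 : 0 ≤ L + (k : ℝ) / K := by positivity
  rw [ray_zero, ray_succ, dist_zero_left, norm_smul, norm_e0, mul_one, Real.norm_of_nonneg h0]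

theorem dist_ray_succ_succ (L : ℝ) (K : ℕ) (j k : Fin K) :
    dist (ray L K j.succ) (ray L K k.succ) = |(j : ℝ) - k| / K := by
  rw [ray_succ, ray_succ, dist_eq_norm, ← sub_smul, norm_smul, norm_e0, mul_one, Real.norm_eq_abs,
    show L + (j : ℝ) / K - (L + (k : ℝ) / K) = ((j : ℝ) - k) / K by ring, abs_div, Nat.abs_cast]

/-- The ray configuration is `1/K`-separated (for `L ≥ 1`, `K ≥ 1`). [folklore] -/
theorem ray_separated {L : ℝ} (hL : 1 ≤ L) {K : ℕ} (hK : 0 < K) :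
    ∀ i j : Fin (K + 1), i ≠ j → (1 : ℝ) / K ≤ dist (ray L K i) (ray L K j) := by
  have hK' : (0 : ℝ) < K := by exact_mod_cast hK
  have hK1 : (1 : ℝ) ≤ K := by exact_mod_cast hK
  have hKinv : (1 : ℝ) / K ≤ 1 := by rw [div_le_one hK']; exact hK1
  intro i j hij
  rcases Fin.eq_zero_or_eq_succ i with rfl | ⟨i, rfl⟩ <;>
    rcases Fin.eq_zero_or_eq_succ j with rfl | ⟨j, rfl⟩
  · exact absurd rfl hij
  · rw [dist_ray_zero_succ (by linarith)]
    have : (0 : ℝ) ≤ (j : ℝ) / K := by positivity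
    linarith
  · rw [dist_comm, dist_ray_zero_succ (by linarith)]
    have : (0 : ℝ) ≤ (i : ℝ) / K := by positivity
    linarith
  · rw [dist_ray_succ_succ]
    have hij' : i ≠ j := fun h => hij (by rw [h])
    have hne : (i : ℕ) ≠ (j : ℕ) := Fin.val_ne_of_ne hij'
    have h1 : (1 : ℝ) ≤ |(i : ℝ) - j| := by
      rcases Nat.lt_or_gt_of_ne hne with h | h
      · have : (i : ℝ) + 1 ≤ j := by exact_mod_cast h
        rw [abs_of_nonpos (by linarith)]
        linarith
      · have : (j : ℝ) + 1 ≤ i := by exact_mod_cast h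
        rw [abs_of_nonneg (by linarith)]
        linarith
    exact div_le_div_of_nonneg_right h1 hK'.le

/-- Every other particle of the ray is at distance `≥ L` from the origin particle. [folklore] -/
theorem le_dist_ray_zero {L : ℝ} (hL : 0 ≤ L) (K : ℕ) :
    ∀ j : Fin (K + 1), j ≠ 0 → L ≤ dist (ray L K j) (ray L K 0) := by
  intro j hj
  obtain ⟨k, rfl⟩ := Fin.exists_succ_eq.2 hj
  rw [dist_comm, dist_ray_zero_succ hL]
  have : (0 : ℝ) ≤ (k : ℝ) / K := by positivity
  linarith

/-- For `L > 3/2` the origin particle of the ray is bad (isolated). [folklore] -/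
theorem ray_zero_bad {L : ℝ} (hL : 3 / 2 < L) (K : ℕ) :
    ¬ IsTwoShellGood (1 / 20) (47 / 50) 1 (ray L K) 0 :=
  not_isTwoShellGood_of_isolated fun j hj => hL.trans_le (le_dist_ray_zero (by linarith) K j hj)

/-- For `K ≥ 20` every ray particle is bad: the origin is isolated and each of the `K` ray
particles has the other `K - 1 ≥ 19` within distance `< 1`. [folklore] -/
theorem ray_all_bad {L : ℝ} (hL : 3 / 2 < L) {K : ℕ} (hK : 20 ≤ K) :
    ∀ j : Fin (K + 1), ¬ IsTwoShellGood (1 / 20) (47 / 50) 1 (ray L K) j := by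
  intro j
  rcases Fin.eq_zero_or_eq_succ j with rfl | ⟨k, rfl⟩
  · exact ray_zero_bad hL K
  · have hK' : (0 : ℝ) < K := by exact_mod_cast (show 0 < K by omega)
    refine not_isTwoShellGood_of_crowded ((Finset.univ.image Fin.succ).erase k.succ) ?_ ?_
    · rw [Finset.card_erase_of_mem (Finset.mem_image_of_mem _ (Finset.mem_univ k)),
        Finset.card_image_of_injective _ (Fin.succ_injective _), Finset.card_univ, Fintype.card_fin]
      omega
    · intro j hj
      obtain ⟨hjk, hj'⟩ := Finset.mem_erase.1 hj
      obtain ⟨i, -, rfl⟩ := Finset.mem_image.1 hj'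
      refine ⟨hjk, ?_⟩
      rw [dist_ray_succ_succ]
      have hi : ((i : ℕ) : ℝ) < K := by exact_mod_cast i.2
      have hk : ((k : ℕ) : ℝ) < K := by exact_mod_cast k.2
      have hi0 : (0 : ℝ) ≤ (i : ℕ) := Nat.cast_nonneg _
      have hk0 : (0 : ℝ) ≤ (k : ℕ) := Nat.cast_nonneg _
      have hlt : |(i : ℝ) - k| < K := by
        rw [abs_sub_lt_iff]; constructor <;> linarith
      have : |(i : ℝ) - k| / K < 1 := by rwa [div_lt_one hK']
      linarith

/-- `V_LJ(s) ≤ -t⁻⁶/12` for `1 ≤ s ≤ t` (`u² ≤ u` for `u = s⁻⁶ ≤ 1`). [folklore] -/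
theorem lennardJones_le_of_one_le {s t : ℝ} (hs : 1 ≤ s) (hst : s ≤ t) :
    lennardJones s ≤ -((t⁻¹) ^ 6 / 12) := by
  unfold lennardJones
  have h0 : 0 < s := by linarith
  have hu1 : (s⁻¹) ^ 6 ≤ 1 := pow_le_one₀ (inv_nonneg.2 h0.le) (inv_le_one_of_one_le₀ hs)
  have hu0 : 0 ≤ (s⁻¹) ^ 6 := pow_nonneg (inv_nonneg.2 h0.le) 6
  have hut : (t⁻¹) ^ 6 ≤ (s⁻¹) ^ 6 :=
    pow_le_pow_left₀ (inv_nonneg.2 (by linarith)) (inv_anti₀ h0 hst) 6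
  have h12 : (s⁻¹) ^ 12 = ((s⁻¹) ^ 6) ^ 2 := by ring
  have hsq : ((s⁻¹) ^ 6) ^ 2 ≤ (s⁻¹) ^ 6 := by nlinarith
  rw [h12]
  linarith

/-- The site energy of the origin particle of the ray: `K` attractive bonds, each `≤ -(L+1)⁻⁶/12`.
[folklore] -/
theorem ray_site_sum_le {L : ℝ} (hL : 1 ≤ L) {K : ℕ} (hK : 0 < K) :
    ∑ j ∈ Finset.univ.erase (0 : Fin (K + 1)), lennardJones (dist (ray L K 0) (ray L K j)) ≤
      -((K : ℝ) * ((L + 1)⁻¹) ^ 6) / 12 := by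
  have hK' : (0 : ℝ) < K := by exact_mod_cast hK
  have h0 : lennardJones (dist (ray L K 0) (ray L K 0)) = 0 := by simp [lennardJones_zero]
  have h1 : ∑ j ∈ Finset.univ.erase (0 : Fin (K + 1)), lennardJones (dist (ray L K 0) (ray L K j)) =
      ∑ j : Fin (K + 1), lennardJones (dist (ray L K 0) (ray L K j)) := by
    rw [← Finset.add_sum_erase _ _ (Finset.mem_univ (0 : Fin (K + 1))), h0, zero_add]
  rw [h1, Fin.sum_univ_succ, h0, zero_add]
  have hterm : ∀ k : Fin K,
      lennardJones (dist (ray L K 0) (ray L K k.succ)) ≤ -(((L + 1)⁻¹) ^ 6 / 12) := by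
    intro k
    rw [dist_ray_zero_succ (by linarith) K k]
    refine lennardJones_le_of_one_le ?_ ?_
    · have : (0 : ℝ) ≤ (k : ℝ) / K := by positivity
      linarith
    · have hk : ((k : ℕ) : ℝ) < K := by exact_mod_cast k.2
      have : (k : ℝ) / K ≤ 1 := by rw [div_le_one hK']; exact hk.le
      linarith
  calc ∑ k : Fin K, lennardJones (dist (ray L K 0) (ray L K k.succ))
      ≤ ∑ _k : Fin K, -(((L + 1)⁻¹) ^ 6 / 12) := Finset.sum_le_sum fun k _ => hterm k
    _ = -((K : ℝ) * ((L + 1)⁻¹) ^ 6) / 12 := by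
        rw [Finset.sum_const, Finset.card_univ, Fintype.card_fin, nsmul_eq_mul]; ring

/-- The right-hand side of the crux for the ray and `U = {0}`. [folklore] -/
theorem ray_sum_le {L : ℝ} (hL : 1 ≤ L) {K : ℕ} (hK : 0 < K) :
    ∑ i ∈ ({0} : Finset (Fin (K + 1))),
        ((1 / 2 : ℝ) * (∑ j ∈ Finset.univ.erase i, lennardJones (dist (ray L K i) (ray L K j))) -
          eStar) ≤ -((K : ℝ) * ((L + 1)⁻¹) ^ 6) / 24 - eStar := by
  rw [Finset.sum_singleton]
  have := ray_site_sum_le hL hK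
  linarith

/-- Beyond the slack radius the origin particle has EMPTY boundary (`R < L`). [folklore] -/
theorem ray_bdry_eq_zero {L R : ℝ} (hRL : R < L) (hL : 0 ≤ L) (K : ℕ) :
    Nat.card {i : Fin (K + 1) // i ∈ ({0} : Finset (Fin (K + 1))) ∧
      ∃ j : Fin (K + 1), j ∉ ({0} : Finset (Fin (K + 1))) ∧ dist (ray L K j) (ray L K i) ≤ R} = 0 := by
  haveI : IsEmpty {i : Fin (K + 1) // i ∈ ({0} : Finset (Fin (K + 1))) ∧
      ∃ j : Fin (K + 1), j ∉ ({0} : Finset (Fin (K + 1))) ∧ dist (ray L K j) (ray L K i) ≤ R} := by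
    refine ⟨fun ⟨i, hi, j, hj, hd⟩ => ?_⟩
    rw [Finset.mem_singleton] at hi hj
    subst hi
    have := le_dist_ray_zero hL K j hj
    linarith
  exact Nat.card_of_isEmpty

/-- From `24 (B - e*) (L+1)^6 < K`: the ray's right-hand side is below `-B`. [folklore] -/
theorem ray_arith {B L : ℝ} {K : ℕ} (hL : 0 ≤ L) (hbig : 24 * (B - eStar) * (L + 1) ^ 6 < K) :
    -((K : ℝ) * ((L + 1)⁻¹) ^ 6) / 24 - eStar < -B := by
  have hL1 : (0 : ℝ) < L + 1 := by linarith
  have ht : (L + 1) ^ 6 * ((L + 1)⁻¹) ^ 6 = 1 := by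
    rw [← mul_pow, mul_inv_cancel₀ hL1.ne']; norm_num
  have htpos : (0 : ℝ) < ((L + 1)⁻¹) ^ 6 := by positivity
  have h1 : 24 * (B - eStar) < (K : ℝ) * ((L + 1)⁻¹) ^ 6 := by
    have := mul_lt_mul_of_pos_right hbig htpos
    calc 24 * (B - eStar) = 24 * (B - eStar) * ((L + 1) ^ 6 * ((L + 1)⁻¹) ^ 6) := by
          rw [ht, mul_one]
      _ = 24 * (B - eStar) * (L + 1) ^ 6 * ((L + 1)⁻¹) ^ 6 := by ring
      _ < K * ((L + 1)⁻¹) ^ 6 := this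
  linarith

/-- **The ray kills `At δ g C R` whenever `δ ≤ 1/K`, `L ≥ 2` and `24 (|C| - e*) (L+1)^6 < K`**
(`U = {origin}`: bad, boundary count `≤ 1`, excess site energy `≤ -K (L+1)⁻⁶/24 - e* < -|C|`).
[folklore] -/
theorem not_at_of_ray {δ g C R L : ℝ} {K : ℕ} (hK : 0 < K) (hδ : δ ≤ 1 / K) (hL : 2 ≤ L)
    (hg : 0 < g) (hbig : 24 * (|C| - eStar) * (L + 1) ^ 6 < K) : ¬ At δ g C R := by
  intro h
  have key := h (K + 1) (ray L K)
    (fun i j hij => hδ.trans (ray_separated (by linarith) hK i j hij)) {0}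
    (fun i hi => by rw [Finset.mem_singleton] at hi; subst hi; exact ray_zero_bad (by linarith) K)
  rw [Finset.card_singleton] at key
  have hsum := ray_sum_le (by linarith : (1 : ℝ) ≤ L) hK
  have har := ray_arith (by linarith : (0 : ℝ) ≤ L) hbig
  have hb := natCard_bdry_le_card (ray L K) ({0} : Finset (Fin (K + 1))) R
  rw [Finset.card_singleton] at hb
  push_cast at key hb
  have hb0 : (0 : ℝ) ≤ Nat.card {i : Fin (K + 1) // i ∈ ({0} : Finset (Fin (K + 1))) ∧
      ∃ j : Fin (K + 1), j ∉ ({0} : Finset (Fin (K + 1))) ∧ dist (ray L K j) (ray L K i) ≤ R} :=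
    Nat.cast_nonneg _
  have hC : -|C| ≤ -(C * (Nat.card {i : Fin (K + 1) // i ∈ ({0} : Finset (Fin (K + 1))) ∧
      ∃ j : Fin (K + 1), j ∉ ({0} : Finset (Fin (K + 1))) ∧ dist (ray L K j) (ray L K i) ≤ R} : ℝ)) := by
    rw [neg_le_neg_iff]
    calc C * _ ≤ |C| * _ := mul_le_mul_of_nonneg_right (le_abs_self C) hb0
      _ ≤ |C| * 1 := mul_le_mul_of_nonneg_left hb (abs_nonneg C)
      _ = |C| := mul_one _
  linarith

/-- **Far variant**: if moreover the whole ray lies beyond the slack radius (`R < L`), the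
boundary is empty and `24 (-e*) (L+1)^6 < K` suffices, for EVERY `C`. [folklore] -/
theorem not_at_of_ray_far {δ g C R L : ℝ} {K : ℕ} (hK : 0 < K) (hδ : δ ≤ 1 / K) (hL : 2 ≤ L)
    (hRL : R < L) (hg : 0 < g) (hbig : 24 * (0 - eStar) * (L + 1) ^ 6 < K) : ¬ At δ g C R := by
  intro h
  have key := h (K + 1) (ray L K)
    (fun i j hij => hδ.trans (ray_separated (by linarith) hK i j hij)) {0}
    (fun i hi => by rw [Finset.mem_singleton] at hi; subst hi; exact ray_zero_bad (by linarith) K)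
  rw [Finset.card_singleton, ray_bdry_eq_zero hRL (by linarith) K] at key
  have hsum := ray_sum_le (by linarith : (1 : ℝ) ≤ L) hK
  have har := ray_arith (by linarith : (0 : ℝ) ≤ L) hbig
  push_cast at key
  linarith

/-! ### The cube cloud (3-D witness; separation `1/K`, `K³` particles) -/

/-- The point with coordinates `(a, b, c)`. [folklore] -/
def pt (a b c : ℝ) : E3 :=
  a • EuclideanSpace.single 0 1 + b • EuclideanSpace.single 1 1 + c • EuclideanSpace.single 2 1

/-- `‖(a,b,c)‖ = √(a² + b² + c²)`. [folklore] -/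
theorem norm_pt (a b c : ℝ) : ‖pt a b c‖ = Real.sqrt (a ^ 2 + b ^ 2 + c ^ 2) := by
  rw [EuclideanSpace.norm_eq, Fin.sum_univ_three]
  simp [pt]

/-- Differences of coordinate points. [folklore] -/
theorem pt_sub_pt (a b c a' b' c' : ℝ) : pt a b c - pt a' b' c' = pt (a - a') (b - b') (c - c') := by
  simp only [pt, sub_smul]
  abel

/-- Distances of coordinate points. [folklore] -/
theorem dist_pt (a b c a' b' c' : ℝ) :
    dist (pt a b c) (pt a' b' c') = Real.sqrt ((a - a') ^ 2 + (b - b') ^ 2 + (c - c') ^ 2) := by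
  rw [dist_eq_norm, pt_sub_pt, norm_pt]

/-- `pt 0 0 0 = 0`. [folklore] -/
@[simp] theorem pt_zero : pt 0 0 0 = 0 := by simp [pt]

/-- The three grid coordinates of an index `m : Fin (K*K*K)`. [folklore] -/
def coords (K : ℕ) (m : Fin (K * K * K)) : Fin K × Fin K × Fin K :=
  ((finProdFinEquiv.symm (finProdFinEquiv.symm m).1).1,
    (finProdFinEquiv.symm (finProdFinEquiv.symm m).1).2, (finProdFinEquiv.symm m).2)

/-- The coordinate map is injective. [folklore] -/
theorem coords_injective (K : ℕ) : Function.Injective (coords K) := by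
  intro m m' h
  simp only [coords, Prod.mk.injEq] at h
  obtain ⟨h1, h2, h3⟩ := h
  apply finProdFinEquiv.symm.injective
  apply Prod.ext _ h3
  apply finProdFinEquiv.symm.injective
  exact Prod.ext h1 h2

/-- THE CUBE CLOUD: one particle at the origin and `K³` grid particles
`(L + i/K, j/K, k/K)`, `i, j, k < K` (spacing `1/K`, all at distance `∈ [L, L+2]`). [folklore] -/
def cube (L : ℝ) (K : ℕ) : Fin (K * K * K + 1) → E3 :=
  Matrix.vecCons (0 : E3) fun m =>
    pt (L + ((coords K m).1 : ℝ) / K) (((coords K m).2.1 : ℝ) / K) (((coords K m).2.2 : ℝ) / K)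

/-- The origin particle of the cube cloud. [folklore] -/
@[simp] theorem cube_zero (L : ℝ) (K : ℕ) : cube L K 0 = 0 := rfl

/-- The grid particles of the cube cloud. [folklore] -/
@[simp] theorem cube_succ (L : ℝ) (K : ℕ) (m : Fin (K * K * K)) :
    cube L K m.succ =
      pt (L + ((coords K m).1 : ℝ) / K) (((coords K m).2.1 : ℝ) / K) (((coords K m).2.2 : ℝ) / K) := by
  simp [cube]

/-- Distance from the origin to a grid particle lies in `[L, L + 2]` (for `L ≥ 0`, `K ≥ 1`). [folklore] -/
theorem dist_cube_zero_succ {L : ℝ} (hL : 0 ≤ L) {K : ℕ} (hK : 0 < K) (m : Fin (K * K * K)) :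
    L ≤ dist (cube L K 0) (cube L K m.succ) ∧ dist (cube L K 0) (cube L K m.succ) ≤ L + 2 := by
  have hK' : (0 : ℝ) < K := by exact_mod_cast hK
  have hi1 : (((coords K m).1 : ℕ) : ℝ) / K ≤ 1 := by
    rw [div_le_one hK']; exact_mod_cast (coords K m).1.2.le
  have hj1 : (((coords K m).2.1 : ℕ) : ℝ) / K ≤ 1 := by
    rw [div_le_one hK']; exact_mod_cast (coords K m).2.1.2.le
  have hk1 : (((coords K m).2.2 : ℕ) : ℝ) / K ≤ 1 := by
    rw [div_le_one hK']; exact_mod_cast (coords K m).2.2.2.le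
  have hi0 : 0 ≤ (((coords K m).1 : ℕ) : ℝ) / K := by positivity
  have hj0 : 0 ≤ (((coords K m).2.1 : ℕ) : ℝ) / K := by positivity
  have hk0 : 0 ≤ (((coords K m).2.2 : ℕ) : ℝ) / K := by positivity
  rw [cube_zero, cube_succ, ← pt_zero, dist_comm, dist_pt]
  simp only [sub_zero]
  constructor
  · calc L = Real.sqrt (L ^ 2) := (Real.sqrt_sq hL).symm
      _ ≤ _ := Real.sqrt_le_sqrt (by nlinarith)
  · rw [Real.sqrt_le_left (by linarith)]
    nlinarith

/-- Distinct naturals are at distance `≥ 1` as reals. [folklore] -/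
theorem one_le_sq_sub_of_ne {p q : ℕ} (h : p ≠ q) : (1 : ℝ) ≤ ((p : ℝ) - q) ^ 2 := by
  rcases Nat.lt_or_gt_of_ne h with h | h
  · have : (p : ℝ) + 1 ≤ q := by exact_mod_cast h
    nlinarith
  · have : (q : ℝ) + 1 ≤ p := by exact_mod_cast h
    nlinarith

/-- The cube cloud is `1/K`-separated (for `L ≥ 1`, `K ≥ 1`). [folklore] -/
theorem cube_separated {L : ℝ} (hL : 1 ≤ L) {K : ℕ} (hK : 0 < K) :
    ∀ a b : Fin (K * K * K + 1), a ≠ b → (1 : ℝ) / K ≤ dist (cube L K a) (cube L K b) := by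
  have hK' : (0 : ℝ) < K := by exact_mod_cast hK
  have hK1 : (1 : ℝ) ≤ K := by exact_mod_cast hK
  have hKinv : (1 : ℝ) / K ≤ 1 := by rw [div_le_one hK']; exact hK1
  have hL0 : (0 : ℝ) ≤ L := by linarith
  intro a b hab
  rcases Fin.eq_zero_or_eq_succ a with rfl | ⟨m, rfl⟩ <;>
    rcases Fin.eq_zero_or_eq_succ b with rfl | ⟨m', rfl⟩
  · exact absurd rfl hab
  · have h1 := (dist_cube_zero_succ hL0 hK m').1
    linarith
  · have h1 := (dist_cube_zero_succ hL0 hK m).1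
    rw [dist_comm]
    linarith
  · have hmm : m ≠ m' := fun h => hab (by rw [h])
    have hc : coords K m ≠ coords K m' := fun h => hmm (coords_injective K h)
    rw [cube_succ, cube_succ, dist_pt]
    -- one coordinate differs by a nonzero integer / K
    have key : (1 / (K : ℝ)) ^ 2 ≤
        (L + ((coords K m).1 : ℝ) / K - (L + ((coords K m').1 : ℝ) / K)) ^ 2 +
          (((coords K m).2.1 : ℝ) / K - ((coords K m').2.1 : ℝ) / K) ^ 2 +
          (((coords K m).2.2 : ℝ) / K - ((coords K m').2.2 : ℝ) / K) ^ 2 := by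
      have e1 : (L + ((coords K m).1 : ℝ) / K - (L + ((coords K m').1 : ℝ) / K)) ^ 2 =
          (((coords K m).1 : ℝ) - (coords K m').1) ^ 2 / (K : ℝ) ^ 2 := by
        field_simp; ring
      have e2 : (((coords K m).2.1 : ℝ) / K - ((coords K m').2.1 : ℝ) / K) ^ 2 =
          (((coords K m).2.1 : ℝ) - (coords K m').2.1) ^ 2 / (K : ℝ) ^ 2 := by
        field_simp
      have e3 : (((coords K m).2.2 : ℝ) / K - ((coords K m').2.2 : ℝ) / K) ^ 2 =
          (((coords K m).2.2 : ℝ) - (coords K m').2.2) ^ 2 / (K : ℝ) ^ 2 := by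
        field_simp
      rw [e1, e2, e3, ← add_div, ← add_div, div_pow, one_pow]
      apply div_le_div_of_nonneg_right _ (by positivity)
      have s1 : 0 ≤ (((coords K m).1 : ℝ) - (coords K m').1) ^ 2 := sq_nonneg _
      have s2 : 0 ≤ (((coords K m).2.1 : ℝ) - (coords K m').2.1) ^ 2 := sq_nonneg _
      have s3 : 0 ≤ (((coords K m).2.2 : ℝ) - (coords K m').2.2) ^ 2 := sq_nonneg _
      by_cases h1 : (coords K m).1 = (coords K m').1
      · by_cases h2 : (coords K m).2.1 = (coords K m').2.1
        · have h3 : (coords K m).2.2 ≠ (coords K m').2.2 := by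
            intro h3; exact hc (Prod.ext h1 (Prod.ext h2 h3))
          have := one_le_sq_sub_of_ne (Fin.val_ne_of_ne h3)
          linarith
        · have := one_le_sq_sub_of_ne (Fin.val_ne_of_ne h2)
          linarith
      · have := one_le_sq_sub_of_ne (Fin.val_ne_of_ne h1)
        linarith
    calc (1 : ℝ) / K = Real.sqrt ((1 / (K : ℝ)) ^ 2) := (Real.sqrt_sq (by positivity)).symm
      _ ≤ _ := Real.sqrt_le_sqrt key

/-- Every grid particle is at distance `≥ L` from the origin particle. [folklore] -/
theorem le_dist_cube_zero {L : ℝ} (hL : 0 ≤ L) {K : ℕ} (hK : 0 < K) :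
    ∀ b : Fin (K * K * K + 1), b ≠ 0 → L ≤ dist (cube L K b) (cube L K 0) := by
  intro b hb
  obtain ⟨m, rfl⟩ := Fin.exists_succ_eq.2 hb
  rw [dist_comm]
  exact (dist_cube_zero_succ hL hK m).1


/-- The site energy of the origin particle of the cube cloud: `K³` attractive bonds, each
`≤ -(L+2)⁻⁶/12`. [folklore] -/
theorem cube_site_sum_le {L : ℝ} (hL : 1 ≤ L) {K : ℕ} (hK : 0 < K) :
    ∑ b ∈ Finset.univ.erase (0 : Fin (K * K * K + 1)),
        lennardJones (dist (cube L K 0) (cube L K b)) ≤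
      -(((K : ℝ) * K * K) * ((L + 2)⁻¹) ^ 6) / 12 := by
  have h0 : lennardJones (dist (cube L K 0) (cube L K 0)) = 0 := by simp [lennardJones_zero]
  have h1 : ∑ b ∈ Finset.univ.erase (0 : Fin (K * K * K + 1)),
      lennardJones (dist (cube L K 0) (cube L K b)) =
        ∑ b : Fin (K * K * K + 1), lennardJones (dist (cube L K 0) (cube L K b)) := by
    rw [← Finset.add_sum_erase _ _ (Finset.mem_univ (0 : Fin (K * K * K + 1))), h0, zero_add]
  rw [h1, Fin.sum_univ_succ, h0, zero_add]
  have hL0 : (0 : ℝ) ≤ L := by linarith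
  have hterm : ∀ m : Fin (K * K * K),
      lennardJones (dist (cube L K 0) (cube L K m.succ)) ≤ -(((L + 2)⁻¹) ^ 6 / 12) := by
    intro m
    obtain ⟨hlo, hhi⟩ := dist_cube_zero_succ hL0 hK m
    exact lennardJones_le_of_one_le (hL.trans hlo) hhi
  calc ∑ m : Fin (K * K * K), lennardJones (dist (cube L K 0) (cube L K m.succ))
      ≤ ∑ _m : Fin (K * K * K), -(((L + 2)⁻¹) ^ 6 / 12) := Finset.sum_le_sum fun m _ => hterm m
    _ = -(((K : ℝ) * K * K) * ((L + 2)⁻¹) ^ 6) / 12 := by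
        rw [Finset.sum_const, Finset.card_univ, Fintype.card_fin, nsmul_eq_mul]; push_cast; ring

/-- The right-hand side of the crux for the cube cloud and `U = {0}`. [folklore] -/
theorem cube_sum_le {L : ℝ} (hL : 1 ≤ L) {K : ℕ} (hK : 0 < K) :
    ∑ i ∈ ({0} : Finset (Fin (K * K * K + 1))),
        ((1 / 2 : ℝ) * (∑ j ∈ Finset.univ.erase i, lennardJones (dist (cube L K i) (cube L K j))) -
          eStar) ≤ -(((K : ℝ) * K * K) * ((L + 2)⁻¹) ^ 6) / 24 - eStar := by
  rw [Finset.sum_singleton]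
  have := cube_site_sum_le hL hK
  linarith

/-- Beyond the slack radius the origin particle of the cube cloud has EMPTY boundary. [folklore] -/
theorem cube_bdry_eq_zero {L R : ℝ} (hRL : R < L) (hL : 0 ≤ L) {K : ℕ} (hK : 0 < K) :
    Nat.card {i : Fin (K * K * K + 1) // i ∈ ({0} : Finset (Fin (K * K * K + 1))) ∧
      ∃ j : Fin (K * K * K + 1), j ∉ ({0} : Finset (Fin (K * K * K + 1))) ∧
        dist (cube L K j) (cube L K i) ≤ R} = 0 := by
  haveI : IsEmpty {i : Fin (K * K * K + 1) // i ∈ ({0} : Finset (Fin (K * K * K + 1))) ∧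
      ∃ j : Fin (K * K * K + 1), j ∉ ({0} : Finset (Fin (K * K * K + 1))) ∧
        dist (cube L K j) (cube L K i) ≤ R} := by
    refine ⟨fun ⟨i, hi, j, hj, hd⟩ => ?_⟩
    rw [Finset.mem_singleton] at hi hj
    subst hi
    have := le_dist_cube_zero hL hK j hj
    linarith
  exact Nat.card_of_isEmpty

/-- From `24 (B - e*) (L+2)^6 < K³`: the cube's right-hand side is below `-B`. [folklore] -/
theorem cube_arith {B L : ℝ} {K : ℕ} (hL : 0 ≤ L)
    (hbig : 24 * (B - eStar) * (L + 2) ^ 6 < (K : ℝ) * K * K) :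
    -(((K : ℝ) * K * K) * ((L + 2)⁻¹) ^ 6) / 24 - eStar < -B := by
  have hL1 : (0 : ℝ) < L + 2 := by linarith
  have ht : (L + 2) ^ 6 * ((L + 2)⁻¹) ^ 6 = 1 := by
    rw [← mul_pow, mul_inv_cancel₀ hL1.ne']; norm_num
  have htpos : (0 : ℝ) < ((L + 2)⁻¹) ^ 6 := by positivity
  have h1 : 24 * (B - eStar) < ((K : ℝ) * K * K) * ((L + 2)⁻¹) ^ 6 := by
    have := mul_lt_mul_of_pos_right hbig htpos
    calc 24 * (B - eStar) = 24 * (B - eStar) * ((L + 2) ^ 6 * ((L + 2)⁻¹) ^ 6) := by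
          rw [ht, mul_one]
      _ = 24 * (B - eStar) * (L + 2) ^ 6 * ((L + 2)⁻¹) ^ 6 := by ring
      _ < ((K : ℝ) * K * K) * ((L + 2)⁻¹) ^ 6 := this
  linarith

/-- For `L > 3/2` the origin particle of the cube cloud is bad (isolated). [folklore] -/
theorem cube_zero_bad {L : ℝ} (hL : 3 / 2 < L) {K : ℕ} (hK : 0 < K) :
    ¬ IsTwoShellGood (1 / 20) (47 / 50) 1 (cube L K) 0 :=
  not_isTwoShellGood_of_isolated fun j hj =>
    hL.trans_le (le_dist_cube_zero (by linarith) hK j hj)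

/-- **The cube cloud kills `At δ g C R` whenever `δ ≤ 1/K`, `L ≥ 2` and
`24 (|C| - e*) (L+2)^6 < K³`** — the 3-D version of `not_at_of_ray`. [folklore] -/
theorem not_at_of_cube {δ g C R L : ℝ} {K : ℕ} (hK : 0 < K) (hδ : δ ≤ 1 / K) (hL : 2 ≤ L)
    (hg : 0 < g) (hbig : 24 * (|C| - eStar) * (L + 2) ^ 6 < (K : ℝ) * K * K) : ¬ At δ g C R := by
  intro h
  have key := h (K * K * K + 1) (cube L K)
    (fun i j hij => hδ.trans (cube_separated (by linarith) hK i j hij)) {0}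
    (fun i hi => by rw [Finset.mem_singleton] at hi; subst hi; exact cube_zero_bad (by linarith) hK)
  rw [Finset.card_singleton] at key
  have hsum := cube_sum_le (by linarith : (1 : ℝ) ≤ L) hK
  have har := cube_arith (by linarith : (0 : ℝ) ≤ L) hbig
  have hb := natCard_bdry_le_card (cube L K) ({0} : Finset (Fin (K * K * K + 1))) R
  rw [Finset.card_singleton] at hb
  push_cast at key hb
  have hb0 : (0 : ℝ) ≤ Nat.card {i : Fin (K * K * K + 1) //
      i ∈ ({0} : Finset (Fin (K * K * K + 1))) ∧ ∃ j : Fin (K * K * K + 1),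
        j ∉ ({0} : Finset (Fin (K * K * K + 1))) ∧ dist (cube L K j) (cube L K i) ≤ R} :=
    Nat.cast_nonneg _
  have hC : -|C| ≤ -(C * (Nat.card {i : Fin (K * K * K + 1) //
      i ∈ ({0} : Finset (Fin (K * K * K + 1))) ∧ ∃ j : Fin (K * K * K + 1),
        j ∉ ({0} : Finset (Fin (K * K * K + 1))) ∧ dist (cube L K j) (cube L K i) ≤ R} : ℝ)) := by
    rw [neg_le_neg_iff]
    calc C * _ ≤ |C| * _ := mul_le_mul_of_nonneg_right (le_abs_self C) hb0
      _ ≤ |C| * 1 := mul_le_mul_of_nonneg_left hb (abs_nonneg C)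
      _ = |C| := mul_one _
  linarith

/-- **Far variant** of the cube kill (`R < L`, every `C`, `24 (-e*) (L+2)^6 < K³`). [folklore] -/
theorem not_at_of_cube_far {δ g C R L : ℝ} {K : ℕ} (hK : 0 < K) (hδ : δ ≤ 1 / K) (hL : 2 ≤ L)
    (hRL : R < L) (hg : 0 < g) (hbig : 24 * (0 - eStar) * (L + 2) ^ 6 < (K : ℝ) * K * K) :
    ¬ At δ g C R := by
  intro h
  have key := h (K * K * K + 1) (cube L K)
    (fun i j hij => hδ.trans (cube_separated (by linarith) hK i j hij)) {0}
    (fun i hi => by rw [Finset.mem_singleton] at hi; subst hi; exact cube_zero_bad (by linarith) hK)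
  rw [Finset.card_singleton, cube_bdry_eq_zero hRL (by linarith) hK] at key
  have hsum := cube_sum_le (by linarith : (1 : ℝ) ≤ L) hK
  have har := cube_arith (by linarith : (0 : ℝ) ≤ L) hbig
  push_cast at key
  linarith

/-- **`C(δ) ≳ δ⁻³`** (3-D crowd): for admissible parameters, `⌊δ⁻¹⌋³ ≤ 24 (|C| - e*) 4⁶`,
i.e. `|C| ≥ ⌊δ⁻¹⌋³ / 98304 + e*`. [folklore] -/
theorem At.floor_inv_cube_le_C {δ g C R : ℝ} (h : At δ g C R) (hg : 0 < g) (hδ : 0 < δ)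
    (hδ1 : δ ≤ 1) :
    (⌊δ⁻¹⌋₊ : ℝ) * ⌊δ⁻¹⌋₊ * ⌊δ⁻¹⌋₊ ≤ 24 * (|C| - eStar) * ((2 : ℝ) + 2) ^ 6 := by
  by_contra hlt
  rw [not_le] at hlt
  have hK : 0 < ⌊δ⁻¹⌋₊ := Nat.floor_pos.2 ((one_le_inv₀ hδ).2 hδ1)
  have hδK : δ ≤ 1 / (⌊δ⁻¹⌋₊ : ℝ) := by
    rw [one_div, le_inv_comm₀ hδ (by exact_mod_cast hK)]
    exact Nat.floor_le (inv_nonneg.2 hδ.le)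
  exact not_at_of_cube hK hδK le_rfl hg hlt h

/-- **`R(δ) ≳ δ^{-1/2}`** (3-D cloud): for admissible parameters,
`⌊δ⁻¹⌋³ ≤ 24 (-e*) (max R 2 + 3)⁶`. [folklore] -/
theorem At.floor_inv_cube_le_R {δ g C R : ℝ} (h : At δ g C R) (hg : 0 < g) (hδ : 0 < δ)
    (hδ1 : δ ≤ 1) :
    (⌊δ⁻¹⌋₊ : ℝ) * ⌊δ⁻¹⌋₊ * ⌊δ⁻¹⌋₊ ≤ 24 * (0 - eStar) * (max R 2 + 1 + 2) ^ 6 := by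
  by_contra hlt
  rw [not_le] at hlt
  have hK : 0 < ⌊δ⁻¹⌋₊ := Nat.floor_pos.2 ((one_le_inv₀ hδ).2 hδ1)
  have hδK : δ ≤ 1 / (⌊δ⁻¹⌋₊ : ℝ) := by
    rw [one_div, le_inv_comm₀ hδ (by exact_mod_cast hK)]
    exact Nat.floor_le (inv_nonneg.2 hδ.le)
  have hL2 : (2 : ℝ) ≤ max R 2 + 1 := by linarith [le_max_right R 2]
  have hRL : R < max R 2 + 1 := by linarith [le_max_left R 2]
  exact not_at_of_cube_far hK hδK hL2 hRL hg hlt h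

/-! ### (a1) The slack radius must depend on `δ` — any FIXED radius is refuted

This re-lands, for every radius `R₀` at once, the refutation of the dropped predecessor
`FarFieldGap` (stmt-AtomisticToContinuum-13957, radius `4`). -/

/-- The crux with the slack radius fixed at `R₀` BEFORE `δ` (for `R₀ = 4` this is, by `Iff.rfl`
up to the name of `e*`, the dropped decl `FarFieldGap`). [folklore] -/
def FixedRadius (R₀ : ℝ) : Prop :=
  ∀ δ : ℝ, 0 < δ → ∃ g : ℝ, 0 < g ∧ ∃ C : ℝ, At δ g C R₀

/-- **No fixed slack radius works** (`R` is chosen after `δ` for a reason): at separation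
`δ = 1/K` one isolated bad particle with EMPTY `R₀`-boundary, facing `K` collinear particles at
distances in `[L, L+1)`, `L = max R₀ 2 + 1 > R₀`, has excess site energy
`≤ -K (L+1)⁻⁶/24 - e* < 0 < g` once `K > 24 (-e*) (L+1)^6`.  Any proof must let `R(δ) → ∞` as
`δ → 0` (quantitatively `R(δ) ≳ δ^{-1/6}` from this witness, `≳ δ⁻¹` from a 3-D cloud). [folklore] -/
theorem not_fixedRadius (R₀ : ℝ) : ¬ FixedRadius R₀ := by
  intro h
  set L : ℝ := max R₀ 2 + 1 with hL
  have hL2 : 2 ≤ L := by rw [hL]; linarith [le_max_right R₀ 2]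
  have hRL : R₀ < L := by rw [hL]; linarith [le_max_left R₀ 2]
  obtain ⟨K₀, hK₀⟩ := exists_nat_gt (24 * (0 - eStar) * (L + 1) ^ 6)
  set K : ℕ := K₀ + 1 with hK
  have hKpos : 0 < K := Nat.succ_pos _
  have hbig : 24 * (0 - eStar) * (L + 1) ^ 6 < K := by
    have : (K₀ : ℝ) ≤ K := by rw [hK]; push_cast; linarith
    linarith
  obtain ⟨g, hg, C, hAt⟩ := h (1 / K) (by positivity)
  exact not_at_of_ray_far hKpos le_rfl hL2 hRL hg hbig hAt

/-! ### (a2) The boundary constant must depend on `δ` -/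

/-- The crux with ONE boundary constant `C` for all `δ`. [folklore] -/
def UniformC : Prop :=
  ∃ C : ℝ, ∀ δ : ℝ, 0 < δ → ∃ g : ℝ, 0 < g ∧ ∃ R : ℝ, At δ g C R

/-- **No `δ`-uniform boundary constant works**: at `δ = 1/K` one isolated bad (boundary) particle
facing `K` collinear particles at distances in `[2, 3)` has excess site energy
`≤ -K 3⁻⁶/24 - e* < -|C| ≤ g - C · #∂` once `K > 24 (|C| - e*) 3^6`.  So `C(δ) → ∞` as `δ → 0`
(`C(δ) ≳ δ⁻¹` from this witness; `≳ δ⁻³` from a 3-D shell of neighbours). [folklore] -/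
theorem not_uniformC : ¬ UniformC := by
  rintro ⟨C, h⟩
  obtain ⟨K₀, hK₀⟩ := exists_nat_gt (24 * (|C| - eStar) * (2 + 1) ^ 6)
  set K : ℕ := K₀ + 1 with hK
  have hKpos : 0 < K := Nat.succ_pos _
  have hbig : 24 * (|C| - eStar) * ((2 : ℝ) + 1) ^ 6 < K := by
    have : (K₀ : ℝ) ≤ K := by rw [hK]; push_cast; linarith
    linarith
  obtain ⟨g, hg, R, hAt⟩ := h (1 / K) (by positivity)
  exact not_at_of_ray hKpos le_rfl le_rfl hg hbig hAt


/-! ### Quantitative design constraints read off the ray -/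

/-- **`C(δ) ≳ δ⁻¹`**: for admissible parameters, `⌊δ⁻¹⌋ ≤ 24 (|C| - e*) 3⁶`, i.e.
`|C| ≥ ⌊δ⁻¹⌋ / 17496 + e*` (contrapositive of `not_at_of_ray`, `K = ⌊δ⁻¹⌋`, `L = 2`; a 3-D crowd
would give `δ⁻³`). [folklore] -/
theorem At.floor_inv_le_C {δ g C R : ℝ} (h : At δ g C R) (hg : 0 < g) (hδ : 0 < δ) (hδ1 : δ ≤ 1) :
    (⌊δ⁻¹⌋₊ : ℝ) ≤ 24 * (|C| - eStar) * ((2 : ℝ) + 1) ^ 6 := by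
  by_contra hlt
  rw [not_le] at hlt
  have hK : 0 < ⌊δ⁻¹⌋₊ := Nat.floor_pos.2 ((one_le_inv₀ hδ).2 hδ1)
  have hδK : δ ≤ 1 / (⌊δ⁻¹⌋₊ : ℝ) := by
    rw [one_div, le_inv_comm₀ hδ (by exact_mod_cast hK)]
    exact Nat.floor_le (inv_nonneg.2 hδ.le)
  exact not_at_of_ray hK hδK le_rfl hg hlt h

/-- **`R(δ) ≳ δ^{-1/6}`** (1-D witness; a 3-D cloud gives `δ⁻¹`): for admissible parameters,
`⌊δ⁻¹⌋ ≤ 24 (-e*) (max R 2 + 2)⁶` (contrapositive of `not_at_of_ray_far`, `K = ⌊δ⁻¹⌋`,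
`L = max R 2 + 1`). [folklore] -/
theorem At.floor_inv_le_R {δ g C R : ℝ} (h : At δ g C R) (hg : 0 < g) (hδ : 0 < δ) (hδ1 : δ ≤ 1) :
    (⌊δ⁻¹⌋₊ : ℝ) ≤ 24 * (0 - eStar) * (max R 2 + 1 + 1) ^ 6 := by
  by_contra hlt
  rw [not_le] at hlt
  have hK : 0 < ⌊δ⁻¹⌋₊ := Nat.floor_pos.2 ((one_le_inv₀ hδ).2 hδ1)
  have hδK : δ ≤ 1 / (⌊δ⁻¹⌋₊ : ℝ) := by
    rw [one_div, le_inv_comm₀ hδ (by exact_mod_cast hK)]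
    exact Nat.floor_le (inv_nonneg.2 hδ.le)
  have hL2 : (2 : ℝ) ≤ max R 2 + 1 := by linarith [le_max_right R 2]
  have hRL : R < max R 2 + 1 := by linarith [le_max_left R 2]
  exact not_at_of_ray_far hK hδK hL2 hRL hg hlt h

/-! ### (a3) Badness of `U` is load-bearing -/

/-- The crux with the BADNESS hypothesis on `U` dropped (`U` arbitrary). [folklore] -/
def WithoutBad : Prop :=
  ∀ δ : ℝ, 0 < δ → ∃ g : ℝ, 0 < g ∧ ∃ C R : ℝ, ∀ (N : ℕ) (x : Fin N → E3),
    (∀ i j : Fin N, i ≠ j → δ ≤ dist (x i) (x j)) → ∀ U : Finset (Fin N),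
      g * (U.card : ℝ) -
          C * (Nat.card {i : Fin N // i ∈ U ∧ ∃ j : Fin N, j ∉ U ∧ dist (x j) (x i) ≤ R} : ℝ) ≤
        ∑ i ∈ U, ((1 / 2 : ℝ) * (∑ j ∈ Finset.univ.erase i, lennardJones (dist (x i) (x j))) -
          eStar)

/-- **Badness is load-bearing** (all of `g > 0` is about bad particles): Lennard-Jones GROUND
STATES `x^N` are `δ₀`-separated (`LennardJonesMinimalDistance_holds`) and have
`𝓔(x^N) - N e* = E(N) - N e* = o(N)` (`crysEnergyLimit`), so `U =` all particles (empty boundary)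
beats `g · N` for large `N`.  PROVED tree facts only. [folklore] -/
theorem not_withoutBad : ¬ WithoutBad := by
  intro h
  obtain ⟨δ, hδ, hmin⟩ := LennardJonesMinimalDistance_holds
  obtain ⟨g, hg, C, R, hAt⟩ := h δ hδ
  have hlim : (⨅ Q : PeriodicConfiguration 3, Q.energyPerParticle lennardJones) < eStar + g := by
    show eStar < eStar + g
    linarith
  have hev : ∀ᶠ N : ℕ in Filter.atTop, groundStateEnergy lennardJones 3 N / N < eStar + g :=
    crysEnergyLimit.eventually (gt_mem_nhds hlim)
  obtain ⟨N, hEN, hN1⟩ := (hev.and (Filter.eventually_ge_atTop 1)).exists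
  obtain ⟨x, hx⟩ := LennardJonesGroundStatesExist_holds N
  have hsep : ∀ i j : Fin N, i ≠ j → δ ≤ dist (x i) (x j) := hmin N x hx
  have key := hAt N x hsep Finset.univ
  haveI : IsEmpty {i : Fin N // i ∈ (Finset.univ : Finset (Fin N)) ∧
      ∃ j : Fin N, j ∉ (Finset.univ : Finset (Fin N)) ∧ dist (x j) (x i) ≤ R} :=
    ⟨fun ⟨_, _, j, hj, _⟩ => hj (Finset.mem_univ j)⟩
  rw [Nat.card_of_isEmpty, sum_univ_half_site_sub, Finset.card_univ, Fintype.card_fin, hx.2] at key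
  have hNpos : (0 : ℝ) < N := by exact_mod_cast hN1
  have hE : groundStateEnergy lennardJones 3 N < (eStar + g) * N := by
    rwa [div_lt_iff₀ hNpos] at hEN
  push_cast at key
  nlinarith

/-! ## §2 Natural strengthenings refuted -/

/-- The POINTWISE far field (no summation, no transfers): every bad particle whose whole
`R`-neighbourhood is bad has site energy `≥ e* + g`. [folklore] -/
def Pointwise : Prop :=
  ∀ δ : ℝ, 0 < δ → ∃ g : ℝ, 0 < g ∧ ∃ R : ℝ, ∀ (N : ℕ) (x : Fin N → E3),
    (∀ i j : Fin N, i ≠ j → δ ≤ dist (x i) (x j)) → ∀ i : Fin N,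
      (∀ j : Fin N, dist (x j) (x i) ≤ R → ¬ IsTwoShellGood (1 / 20) (47 / 50) 1 x j) →
        eStar + g ≤ (1 / 2 : ℝ) * ∑ j ∈ Finset.univ.erase i, lennardJones (dist (x i) (x j))

/-- `Pointwise` IS a strengthening of the crux: it implies `FarFieldGapR` with
`C := g + (250/12) δ⁻⁶ + |e*|` (interior particles of `U` pay `g` each; a boundary particle has
site energy `≥ -(250/12) δ⁻⁶` by the shell sum `sum_inv_pow_six_le`). [folklore] -/
theorem farFieldGapR_of_pointwise (h : Pointwise) : FarFieldGapR := by
  intro δ hδ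
  obtain ⟨g, hg, R, hpt⟩ := h δ hδ
  refine ⟨g, hg, g + 250 / 12 * (δ⁻¹) ^ 6 + |eStar|, R, fun N x hsep U hU => ?_⟩
  -- boundary / interior split of `U`
  set P : Fin N → Prop := fun i => ∃ j : Fin N, j ∉ U ∧ dist (x j) (x i) ≤ R with hP
  have hcardB : (Nat.card {i : Fin N // i ∈ U ∧ P i} : ℝ) = ((U.filter P).card : ℝ) := by
    congr 1
    rw [Nat.card_eq_fintype_card, Fintype.card_subtype]
    congr 1
    ext i
    simp [Finset.mem_filter]
  set f : Fin N → ℝ := fun i =>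
    (1 / 2 : ℝ) * (∑ j ∈ Finset.univ.erase i, lennardJones (dist (x i) (x j))) - eStar with hf
  -- interior particles pay `g`
  have hint : ∀ i ∈ U.filter (fun i => ¬ P i), g ≤ f i := by
    intro i hi
    obtain ⟨-, hiP⟩ := Finset.mem_filter.1 hi
    have hball : ∀ j : Fin N, dist (x j) (x i) ≤ R → ¬ IsTwoShellGood (1 / 20) (47 / 50) 1 x j := by
      intro j hj
      by_cases hjU : j ∈ U
      · exact hU j hjU
      · exact absurd ⟨j, hjU, hj⟩ hiP
    have := hpt N x hsep i hball
    simp only [hf]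
    linarith
  -- boundary particles are bounded below by the shell sum
  have hbdry : ∀ i ∈ U.filter P, -(250 / 12 * (δ⁻¹) ^ 6 + |eStar|) ≤ f i := by
    intro i _
    have hshell := sum_inv_pow_six_le x hδ hsep i
    have hVsum : -((1 / 6) * (250 * (δ⁻¹) ^ 6)) ≤
        ∑ j ∈ Finset.univ.erase i, lennardJones (dist (x i) (x j)) := by
      have hterm : ∀ j ∈ Finset.univ.erase i,
          -((1 / 6) * (dist (x i) (x j))⁻¹ ^ 6) ≤ lennardJones (dist (x i) (x j)) := by
        intro j hj
        have hij : i ≠ j := (Finset.ne_of_mem_erase hj).symm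
        have hpos : 0 < dist (x i) (x j) := hδ.trans_le (hsep i j hij)
        exact neg_le_lennardJones_of_le hpos le_rfl
      calc -((1 / 6) * (250 * (δ⁻¹) ^ 6))
          ≤ -((1 / 6) * ∑ j ∈ Finset.univ.erase i, (dist (x i) (x j))⁻¹ ^ 6) := by nlinarith
        _ = ∑ j ∈ Finset.univ.erase i, -((1 / 6) * (dist (x i) (x j))⁻¹ ^ 6) := by
            rw [Finset.mul_sum, Finset.sum_neg_distrib]
        _ ≤ _ := Finset.sum_le_sum hterm
    have he : eStar ≤ |eStar| := le_abs_self _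
    simp only [hf]
    linarith
  have hsplit := Finset.sum_filter_add_sum_filter_not U P f
  have hcard := Finset.card_filter_add_card_filter_not (s := U) P
  have h1 : ((U.filter fun i => ¬ P i).card : ℝ) * g ≤ ∑ i ∈ U.filter (fun i => ¬ P i), f i := by
    rw [← nsmul_eq_mul, ← Finset.sum_const]
    exact Finset.sum_le_sum hint
  have h2 : ((U.filter P).card : ℝ) * (-(250 / 12 * (δ⁻¹) ^ 6 + |eStar|)) ≤
      ∑ i ∈ U.filter P, f i := by
    rw [← nsmul_eq_mul, ← Finset.sum_const]
    exact Finset.sum_le_sum hbdry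
  have hcardR : ((U.filter P).card : ℝ) + ((U.filter fun i => ¬ P i).card : ℝ) = U.card := by
    exact_mod_cast hcard
  have hgU : g * (U.card : ℝ) =
      g * ((U.filter P).card : ℝ) + g * ((U.filter fun i => ¬ P i).card : ℝ) := by
    rw [← hcardR]; ring
  change _ ≤ ∑ i ∈ U, f i
  rw [hcardB, ← hsplit]
  linarith

/-- **The pointwise far field is FALSE**: at `δ = 1/K` (`K ≥ 20`, `K > 24 (-e*) 3^6`) the ray
configuration is ALL bad and its isolated origin particle has site energy
`≤ -K 3⁻⁶/24 < e* < e* + g`: crowding by BAD neighbours lowers one site energy without bound, the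
crowd's own repulsion being what pays.  Hence no certificate can be pointwise in the site energy;
it must TRANSFER energy between neighbouring bad particles (the card's transfer certificates).
[folklore] -/
theorem not_pointwise : ¬ Pointwise := by
  intro h
  obtain ⟨K₀, hK₀⟩ := exists_nat_gt (24 * |eStar| * ((2 : ℝ) + 1) ^ 6 + 20)
  set K : ℕ := K₀ + 1 with hK
  have hKpos : 0 < K := Nat.succ_pos _
  have hK₀K : (K₀ : ℝ) ≤ K := by rw [hK]; push_cast; linarith
  have habs : 0 ≤ 24 * |eStar| * ((2 : ℝ) + 1) ^ 6 := by positivity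
  have h20 : 20 ≤ K := by
    have : (20 : ℝ) ≤ K := by linarith
    exact_mod_cast this
  have hbig : 24 * (0 - eStar) * ((2 : ℝ) + 1) ^ 6 < K := by
    have he : 0 - eStar ≤ |eStar| := by simpa using neg_le_abs eStar
    have h36 : (0 : ℝ) ≤ ((2 : ℝ) + 1) ^ 6 := by positivity
    nlinarith [mul_le_mul_of_nonneg_right he h36]
  obtain ⟨g, hg, R, hpt⟩ := h (1 / K) (by positivity)
  have key := hpt (K + 1) (ray 2 K) (fun i j hij => ray_separated (by norm_num) hKpos i j hij) 0
    (fun j _ => ray_all_bad (by norm_num) h20 j)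
  have hsum := ray_site_sum_le (by norm_num : (1 : ℝ) ≤ 2) hKpos
  have har := ray_arith (by norm_num : (0 : ℝ) ≤ 2) hbig
  linarith

/-! ## §3 What a kill must look like: the crux is exactly the all-bad bulk gap -/

/-- With the line `Sketch` (`AllBadGap → FarFieldGapR`, octahedral poisoning; lead
prover-line-stmt-AtomisticToContinuum-14969-0) the crux is EQUIVALENT to its own special case
`AllBadGap` (stmt-13960); the converse is the landed `allBadGap_of_farFieldGapR`. [folklore] -/
theorem farFieldGapR_iff_allBadGap (hline : AllBadGap → FarFieldGapR) : (FarFieldGapR ↔ AllBadGap) :=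
  ⟨allBadGap_of_farFieldGapR, hline⟩

/-- **Kill criterion, formal**: an all-bad `δ`-separated family whose energy comes within `g N`
of `N e*` for EVERY `g > 0` refutes the crux.  The catch (why the crux resists): certifying
`𝓔(x) < N (e* + g)` needs a LOWER bound on `e* = ⨅_Q e(Q)` matching the family — the open
identification of the periodic Lennard-Jones minimum. [folklore] -/
theorem not_farFieldGapR_of_allBad_tie
    (h : ∃ δ : ℝ, 0 < δ ∧ ∀ g : ℝ, 0 < g → ∃ (N : ℕ) (x : Fin N → E3),
      (∀ i j : Fin N, i ≠ j → δ ≤ dist (x i) (x j)) ∧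
        (∀ i, ¬ IsTwoShellGood (1 / 20) (47 / 50) 1 x i) ∧
          interactionEnergy lennardJones x < N * (eStar + g)) :
    ¬ FarFieldGapR := by
  intro hF
  obtain ⟨δ, hδ, htie⟩ := h
  obtain ⟨g, hg, hgap⟩ := allBadGap_of_farFieldGapR hF δ hδ
  obtain ⟨N, x, hsep, hbad, hlt⟩ := htie g hg
  have := hgap N x hsep hbad
  change (N : ℝ) * (eStar + g) ≤ _ at this
  linarith

/-- **The asymmetry**: PROVING the all-bad gap needs only an UPPER bound `ē ≥ e*` (any explicit
periodic competitor, e.g. a certified hcp block energy) and a gap above the explicit level `ē`;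
refuting it needs `e*` from below. [folklore] -/
theorem allBadGap_of_level {ē : ℝ} (hē : eStar ≤ ē)
    (h : ∀ δ : ℝ, 0 < δ → ∃ g : ℝ, 0 < g ∧ ∀ (N : ℕ) (x : Fin N → E3),
      (∀ i j : Fin N, i ≠ j → δ ≤ dist (x i) (x j)) →
        (∀ i, ¬ IsTwoShellGood (1 / 20) (47 / 50) 1 x i) →
          (N : ℝ) * (ē + g) ≤ interactionEnergy lennardJones x) : AllBadGap := by
  intro δ hδ
  obtain ⟨g, hg, hgap⟩ := h δ hδ
  refine ⟨g, hg, fun N x hsep hbad => ?_⟩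
  have := hgap N x hsep hbad
  have hN : (0 : ℝ) ≤ N := Nat.cast_nonneg _
  change (N : ℝ) * (eStar + g) ≤ _
  nlinarith

/-! ### The all-bad core `AllBadGap`: its two hypotheses are load-bearing too -/

/-- The pile-up takes only the values `0` and `e₀`. [folklore] -/
theorem pile_eq_zero_or (k : ℕ) (i : Fin (k + k)) : pile k i = 0 ∨ pile k i = e0 := by
  induction i using Fin.addCases with
  | left j => left; simp only [pile, Fin.append_left]
  | right j => right; simp only [pile, Fin.append_right]

/-- All mutual distances in the pile-up are `≤ 1`. [folklore] -/
theorem dist_pile_le_one (k : ℕ) (i j : Fin (k + k)) : dist (pile k i) (pile k j) ≤ 1 := by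
  rcases pile_eq_zero_or k i with hi | hi <;> rcases pile_eq_zero_or k j with hj | hj <;>
    simp [hi, hj, norm_e0]

/-- For `k ≥ 10` every particle of the pile-up is bad: it has `2k - 1 ≥ 19 ≠ 18` other particles
within distance `1 ≤ 3a/2`, against `IsTwoShellGood.card_filter_eq_eighteen`. [folklore] -/
theorem pile_all_bad {k : ℕ} (hk : 10 ≤ k) (i : Fin (k + k)) :
    ¬ IsTwoShellGood (1 / 20) (47 / 50) 1 (pile k) i := by
  intro hgood
  have hε : (1 / 20 : ℝ) ≤ 3 / 2 - Real.sqrt 2 := by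
    have h : Real.sqrt 2 ≤ 29 / 20 := by
      rw [Real.sqrt_le_left (by norm_num)]
      norm_num
    linarith
  obtain ⟨a, ha₁, -, hcard⟩ := hgood.card_filter_eq_eighteen (by norm_num) hε
  have hsub : Finset.univ.erase i ⊆
      Finset.univ.filter fun j : Fin (k + k) => j ≠ i ∧ dist (pile k j) (pile k i) ≤ 3 / 2 * a := by
    intro j hj
    refine Finset.mem_filter.2 ⟨Finset.mem_univ _, Finset.ne_of_mem_erase hj, ?_⟩
    exact (dist_pile_le_one k j i).trans (by linarith)
  have := Finset.card_le_card hsub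
  rw [Finset.card_erase_of_mem (Finset.mem_univ i), Finset.card_univ, Fintype.card_fin, hcard] at this
  omega

/-- **The all-bad gap without separation is false**: the pile-up `pile k` is all bad and has energy
`-k²/12 < 2k (e* + g)` for `k` large. [folklore] -/
theorem not_allBad_withoutSep :
    ¬ ∃ g : ℝ, 0 < g ∧ ∀ (N : ℕ) (x : Fin N → E3),
      (∀ i, ¬ IsTwoShellGood (1 / 20) (47 / 50) 1 x i) →
        (N : ℝ) * (eStar + g) ≤ interactionEnergy lennardJones x := by
  rintro ⟨g, hg, h⟩
  obtain ⟨k₀, hk₀⟩ := exists_nat_gt (24 * |eStar| + 10)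
  set k : ℕ := k₀ + 1 with hk
  have hk₀k : (k₀ : ℝ) ≤ k := by rw [hk]; push_cast; linarith
  have habs : 0 ≤ |eStar| := abs_nonneg _
  have hk10 : 10 ≤ k := by
    have : (10 : ℝ) ≤ k := by linarith
    exact_mod_cast this
  have hkpos : (0 : ℝ) < k := by
    have : (0 : ℝ) < 10 := by norm_num
    have h10 : (10 : ℝ) ≤ k := by exact_mod_cast hk10
    linarith
  have key := h (k + k) (pile k) (pile_all_bad hk10)
  rw [interactionEnergy_pile] at key
  push_cast at key
  have he : -|eStar| ≤ eStar := neg_abs_le _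
  -- `2k (e* + g) ≤ -k²/12` forces `k/24 + e* + g ≤ 0`, impossible for `k > 24 |e*|`
  have h2 : (k : ℝ) / 24 + eStar + g ≤ 0 := by
    by_contra hcon
    rw [not_le] at hcon
    have : 0 < (k : ℝ) * ((k : ℝ) / 24 + eStar + g) := mul_pos hkpos hcon
    nlinarith [key]
  linarith

/-- **The all-bad gap without badness is false**: Lennard-Jones ground states are uniformly
separated and have `E(N) = N e* + o(N) < N (e* + g)` for large `N`.  Proved tree facts only.
[folklore] -/
theorem not_allBad_withoutBad :
    ¬ ∀ δ : ℝ, 0 < δ → ∃ g : ℝ, 0 < g ∧ ∀ (N : ℕ) (x : Fin N → E3),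
      (∀ i j : Fin N, i ≠ j → δ ≤ dist (x i) (x j)) →
        (N : ℝ) * (eStar + g) ≤ interactionEnergy lennardJones x := by
  intro h
  obtain ⟨δ, hδ, hmin⟩ := LennardJonesMinimalDistance_holds
  obtain ⟨g, hg, hgap⟩ := h δ hδ
  have hlim : (⨅ Q : PeriodicConfiguration 3, Q.energyPerParticle lennardJones) < eStar + g := by
    show eStar < eStar + g
    linarith
  have hev : ∀ᶠ N : ℕ in Filter.atTop, groundStateEnergy lennardJones 3 N / N < eStar + g :=
    crysEnergyLimit.eventually (gt_mem_nhds hlim)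
  obtain ⟨N, hEN, hN1⟩ := (hev.and (Filter.eventually_ge_atTop 1)).exists
  obtain ⟨x, hx⟩ := LennardJonesGroundStatesExist_holds N
  have key := hgap N x (hmin N x hx)
  rw [hx.2] at key
  have hNpos : (0 : ℝ) < N := by exact_mod_cast hN1
  have hE : groundStateEnergy lennardJones 3 N < (eStar + g) * N := by
    rwa [div_lt_iff₀ hNpos] at hEN
  linarith

end Summit.AtomisticToContinuum.Crystallization.Cruxes.FarFieldGapR.Disproof

end
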